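/-
Copyright: statement-level skeleton of a published paper (lit-balaban cell, Phase-2 proof seat p32 gen 41). No proof claims
beyond what the kernel checks below.
-/
import Mathlib
import Literature.MathematicalPhysics.QuantumFieldTheory.Balaban1983to89.B3Eq121OnePIChains

/-!
# B3 — T. Bałaban, *(Higgs)₂,₃ quantum fields in a finite volume. III. Renormalization*, CMP **88** (1983) 411–445
[Balaban1983Higgs3], p. 416 [PDF 6], display **(1.21)** WITH ITS PRINTED LETTERS: the insertion
`X = −δm² + Σ^ε + ∂^{ε*}Σ^ε_1 + Σ^{ε*}_1∂^ε + ∂^{ε*}Σ^ε_2∂^ε` of the Dyson/1PI chain resummation as a formal power series in the couplings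

statement-level skeleton of published theorems with citation tags; proofs where landed; nothing here is a claim about
the Yang–Mills mass gap

THE PRINTED TEXT, p. 416 [PDF 6], verbatim: *"The function G^ε has a perturbative expansion of the following structure
G^ε = Σ_{n=0}^{∞} C^ε_0[(−δm² + Σ^ε + ∂^{ε*}Σ^ε_1 + Σ^{ε*}_1∂^ε + ∂^{ε*}Σ^ε_2∂^ε)C^ε_0]ⁿ, (1.21) where C^ε_0 = (−Δ^ε_0 + m²)^{−1} and
Σ^ε, Σ^ε_1, Σ^ε_2 are given by amputated, one-particle-irreducible graphs of the expansion of G^ε."*  p. 417 [PDF 7]: *"More exactly we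
write δm² = Σ_{2≦α+2β≦4} e^αλ^β δm²_{(α,β)}"* ((1.23)).

PDF held: `paper:balaban1983-higgs-2-3-quantum-fields-finite-volume` (journal page = PDF page + 410).  SKELETON row **B3.Eq1.19-1.22**
(`HOME/lit-balaban-r15/ROWS-B3.md`, fold owner r15), the (1.21) cell; companion (theorems only) of p32 gen 41's `B3Eq121OnePIChains`
(p358597), which proves (1.21) as the chain resummation `Eq121 G (C C₀) X` in `MvPowerSeries σ R` for ONE family of insertion kernels
`amp : ι → R` with orders `deg : ι → σ →₀ ℕ`, `X = sigmaSeries amp deg`.  THIS FILE spells `X` out in PRINT'S FIVE LETTERS, by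
name over r15's `B3Sect1TwoPoint.selfEnergy121 dm2 Sg Sg1 Sg1s Sg2 d ds = −dm2 + Sg + ds·Sg1 + Sg1s·d + ds·Sg2·d`:
the insertions come in five kinds — the mass-counterterm insertions `−δm²` (kernels `−dm2 i`; indexed e.g. by the orders `(α, β)` of
(1.23) — a bare vertex (1.7) is NOT a graph, p. 415 *"There is at least one internal line"*, which is why print lists `−δm²`
separately from `Σ^ε`; p37's remark 2026-08-23T08:13:46Z), the amputated 1PI graphs without derivative legs (`Σ^ε`, kernels `K i`),
with the left external leg differentiated (`∂^{ε*}Σ^ε_1`, kernels `ds·K₁ i`), with the right one (`Σ^{ε*}_1∂^ε`, kernels `K₁s i·d`), with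
both (`∂^{ε*}Σ^ε_2∂^ε`, kernels `ds·K₂ i·d`) — the index type is the disjoint union `ι₀ ⊕ ι₁ ⊕ ι₂ ⊕ ι₃ ⊕ ι₄` and:
* `§1` `sigmaSeries` is additive and `R`-linear in the kernels (`sigmaSeries_neg`, `sigmaSeries_const_mul`, `sigmaSeries_mul_const`,
  `sigmaSeries_const_mul_const`), a finite family gives the POLYNOMIAL `Σ_i e^{deg i}·amp i` (`sigmaSeries_eq_sum_monomial`);
* `§2` **`sigmaSeries_selfEnergy121`** — the series of the five-kind family IS `selfEnergy121 (Σ_i e^{deg}dm2 i) (Σ e^{deg}K) (Σ e^{deg}K₁)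
  (Σ e^{deg}K₁s) (Σ e^{deg}K₂) (C ∂) (C ∂*)`; hence **`eq121_selfEnergy121`** — (1.21) WITH ITS LETTERS holds exactly in `R[[σ]]`:
  `Eq121 G (C C₀) (selfEnergy121 …)` for `G` = the chain series, **`greenSeries_eq_tsum_selfEnergy121`** — `G = Σ'_{n} C₀[(−δm² + Σ +
  ∂*Σ₁ + Σ₁*∂ + ∂*Σ₂∂)C₀]ⁿ` literally, and **`eq_greenSeries_of_eq121_selfEnergy121`** (uniqueness);
* `§3` the `−δm²` letter with (1.23): indexing the counterterm insertions by r15's `idx123` (`2 ≤ α + 2β ≤ 4`) with orders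
  `e^αλ^β ↦ single 0 α + single 1 β : Fin 2 →₀ ℕ` (positive: `order123_ne_zero`), their series is the polynomial
  `Σ_{(α,β) ∈ idx123} e^αλ^β·δm²_{(α,β)}` (`sigmaSeries_idx123`) — the formal-series form of r15's numeric `dm2Of123`.
* `§4` transport: for ANY indexing `γ` of the connected two-point graphs with a bijection `γ ≃ List ι` onto the chains of 1PI pieces
  respecting kernels and orders (the bridge decomposition supplied as data), the generating series of `γ` is `greenSeries`, hence
  satisfies (1.21) (`sigmaSeries_eq_greenSeries_of_equiv`, `eq121_sigmaSeries_of_equiv`, `sigmaSeries_eq_tsum_dysonTerm_of_equiv`).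
HONEST SCOPE as in `B3Eq121OnePIChains`: kernel/series level; `∂^ε`, `∂^{ε*}` are single ring letters as in r15's `selfEnergy121` (print
sums over `μ`); which graphs belong to which kind is input (`ι₁, …, ι₄`), not derived — a model predicate «one-particle-irreducible» on
p18's concrete graphs `B3Cor23Concrete.Graph` is p37's `B3OnePIGraphs.IsOnePI` (p358806: connected — `B3OnePIGraphs.IsConnected`, p. 415
*"connected in the usual sense"* — and connected after cutting any one internal line; the seven (1.22) pictures decided there,
`pictures122_isOnePI`); instantiating `ι₁, …, ι₄` with such graphs would need their amputated kernels as a function on graphs, which the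
tree does not have; no Wick step, no link to (1.19) (the all-orders Taylor coefficients of (1.19) are p33's lane).  v1.1 (doc-only):
the name of p37's predicate corrected (v1.0 wrote `B3OnePIGraphs.Graph.IsOnePI`); declarations byte-identical.  Theorems only
(no definitions, no `Prop` facts, no sorry); Mathlib + `B3Eq121OnePIChains`; standard axioms.  Unit `lit-balaban-p32` (gen 41), 2026-08-23.
-/

open scoped BigOperators

namespace Literature.MathematicalPhysics.QuantumFieldTheory.Balaban1983to89.B3Eq121OnePIChainsLetters

open B3Sect1TwoPoint (dysonTerm Eq121 selfEnergy121 idx123)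
open B3Eq121OnePIChains
open MvPowerSeries

variable {R : Type*} [Ring R] {σ : Type*}

/-! ## §1 The self-energy series is additive and linear in the kernels -/

section Linear

variable {ι : Type*} {amp : ι → R} {deg : ι → σ →₀ ℕ}

/-- `Σ_i e^{deg i}·(−amp i) = −Σ_i e^{deg i}·amp i` (the sign of print's `−δm²`). PROVED. [cite: Balaban1983Higgs3, (1.21) p.416] -/
theorem sigmaSeries_neg (hfin : ∀ d, {i | deg i = d}.Finite) :
    sigmaSeries (fun i => -amp i) deg = -sigmaSeries amp deg := by
  ext d
  rw [map_neg, coeff_sigmaSeries hfin, coeff_sigmaSeries hfin, Finset.sum_neg_distrib]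

/-- a constant LEFT letter factors out: `Σ_i e^{deg i}·(a·amp i) = C a·Σ_i e^{deg i}·amp i` (print's `∂^{ε*}Σ^ε_1`). PROVED.
[cite: Balaban1983Higgs3, (1.21) p.416] -/
theorem sigmaSeries_const_mul (hfin : ∀ d, {i | deg i = d}.Finite) (a : R) :
    sigmaSeries (fun i => a * amp i) deg = C a * sigmaSeries amp deg := by
  ext d
  rw [coeff_C_mul, coeff_sigmaSeries hfin, coeff_sigmaSeries hfin, Finset.mul_sum]

/-- a constant RIGHT letter factors out: `Σ_i e^{deg i}·(amp i·a) = (Σ_i e^{deg i}·amp i)·C a` (print's `Σ^{ε*}_1∂^ε`). PROVED.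
[cite: Balaban1983Higgs3, (1.21) p.416] -/
theorem sigmaSeries_mul_const (hfin : ∀ d, {i | deg i = d}.Finite) (a : R) :
    sigmaSeries (fun i => amp i * a) deg = sigmaSeries amp deg * C a := by
  ext d
  rw [coeff_mul_C, coeff_sigmaSeries hfin, coeff_sigmaSeries hfin, Finset.sum_mul]

/-- both: `Σ_i e^{deg i}·(a·amp i·b) = C a·(Σ_i e^{deg i}·amp i)·C b` (print's `∂^{ε*}Σ^ε_2∂^ε`). PROVED.
[cite: Balaban1983Higgs3, (1.21) p.416] -/
theorem sigmaSeries_const_mul_const (hfin : ∀ d, {i | deg i = d}.Finite) (a b : R) :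
    sigmaSeries (fun i => a * amp i * b) deg = C a * sigmaSeries amp deg * C b := by
  ext d
  rw [coeff_mul_C, coeff_C_mul, coeff_sigmaSeries hfin, coeff_sigmaSeries hfin, Finset.mul_sum, Finset.sum_mul]

/-- A FINITE family of insertions gives a polynomial in the couplings: `X = Σ_i e^{deg i}·amp i` as a finite sum of monomials.
PROVED. [cite: Balaban1983Higgs3, (1.21) p.416] -/
theorem sigmaSeries_eq_sum_monomial [Fintype ι] [DecidableEq σ] (amp : ι → R) (deg : ι → σ →₀ ℕ) :
    sigmaSeries amp deg = ∑ i, monomial (deg i) (amp i) := by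
  ext d
  rw [coeff_sigmaSeries (fun d => Set.toFinite _), map_sum]
  simp_rw [coeff_monomial]
  rw [Finset.sum_ite, Finset.sum_const_zero, add_zero]
  refine Finset.sum_congr ?_ fun _ _ => rfl
  ext i
  simp [eq_comm]

end Linear

/-! ## §2 Print's five letters: `X = −δm² + Σ^ε + ∂^{ε*}Σ^ε_1 + Σ^{ε*}_1∂^ε + ∂^{ε*}Σ^ε_2∂^ε` -/

section Letters

variable {ι₀ ι₁ ι₂ ι₃ ι₄ : Type*}

/-- kernel: a disjoint union of two locally finite graded families is locally finite. [cite: Balaban1983Higgs3, (1.21) p.416] -/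
theorem finite_fiber_sum_elim {κ₁ κ₂ : Type*} {e₁ : κ₁ → σ →₀ ℕ} {e₂ : κ₂ → σ →₀ ℕ}
    (h₁ : ∀ d, {i | e₁ i = d}.Finite) (h₂ : ∀ d, {i | e₂ i = d}.Finite) (d : σ →₀ ℕ) :
    {i | Sum.elim e₁ e₂ i = d}.Finite := by
  refine (((h₁ d).image Sum.inl).union ((h₂ d).image Sum.inr)).subset ?_
  rintro (i | i) hi
  · exact Or.inl ⟨i, hi, rfl⟩
  · exact Or.inr ⟨i, hi, rfl⟩

/-- kernel: a disjoint union of two families of positive order has positive orders. [cite: Balaban1983Higgs3, (1.21) p.416] -/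
theorem sum_elim_ne_zero {κ₁ κ₂ : Type*} {e₁ : κ₁ → σ →₀ ℕ} {e₂ : κ₂ → σ →₀ ℕ}
    (h₁ : ∀ i, e₁ i ≠ 0) (h₂ : ∀ i, e₂ i ≠ 0) (i : κ₁ ⊕ κ₂) : Sum.elim e₁ e₂ i ≠ 0 := by
  rcases i with i | i
  · exact h₁ i
  · exact h₂ i

variable (a₀ : ι₀ → R) (a₁ : ι₁ → R) (a₂ : ι₂ → R) (a₃ : ι₃ → R) (a₄ : ι₄ → R)
  (e₀ : ι₀ → σ →₀ ℕ) (e₁ : ι₁ → σ →₀ ℕ) (e₂ : ι₂ → σ →₀ ℕ) (e₃ : ι₃ → σ →₀ ℕ) (e₄ : ι₄ → σ →₀ ℕ)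

/-- Five kinds of insertions: the self-energy series of the disjoint union is the sum of the five series. PROVED.
[cite: Balaban1983Higgs3, (1.21) p.416] -/
theorem sigmaSeries_sum5 (h₀ : ∀ d, {i | e₀ i = d}.Finite) (h₁ : ∀ d, {i | e₁ i = d}.Finite)
    (h₂ : ∀ d, {i | e₂ i = d}.Finite) (h₃ : ∀ d, {i | e₃ i = d}.Finite) (h₄ : ∀ d, {i | e₄ i = d}.Finite) :
    sigmaSeries (Sum.elim a₀ (Sum.elim a₁ (Sum.elim a₂ (Sum.elim a₃ a₄))))
        (Sum.elim e₀ (Sum.elim e₁ (Sum.elim e₂ (Sum.elim e₃ e₄))))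
      = sigmaSeries a₀ e₀ + sigmaSeries a₁ e₁ + sigmaSeries a₂ e₂ + sigmaSeries a₃ e₃ + sigmaSeries a₄ e₄ := by
  have h₃₄ := finite_fiber_sum_elim h₃ h₄
  have h₂₃₄ := finite_fiber_sum_elim h₂ h₃₄
  have h₁₂₃₄ := finite_fiber_sum_elim h₁ h₂₃₄
  rw [sigmaSeries_sum a₀ e₀ _ _ h₀ h₁₂₃₄, sigmaSeries_sum a₁ e₁ _ _ h₁ h₂₃₄, sigmaSeries_sum a₂ e₂ _ _ h₂ h₃₄,
    sigmaSeries_sum a₃ e₃ a₄ e₄ h₃ h₄]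
  simp only [add_assoc]

variable (dm2 : ι₀ → R) (K : ι₁ → R) (K₁ : ι₂ → R) (K₁s : ι₃ → R) (K₂ : ι₄ → R) (d ds : R)

/-- **PRINT'S FIVE LETTERS**: for the five-kind family of insertions — mass counterterms with kernels `−dm2 i`, 1PI graphs `K i`,
left-differentiated `∂*·K₁ i`, right-differentiated `K₁s i·∂`, both `∂*·K₂ i·∂` — the self-energy series IS r15's
`selfEnergy121 (−δm²-series) (Σ-series) (Σ₁-series) (Σ₁*-series) (Σ₂-series) (C ∂) (C ∂*)`
`= −Σe^{deg}dm2 + Σe^{deg}K + C ∂*·Σe^{deg}K₁ + Σe^{deg}K₁s·C ∂ + C ∂*·Σe^{deg}K₂·C ∂`. PROVED. [cite: Balaban1983Higgs3, (1.21) p.416] -/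
theorem sigmaSeries_selfEnergy121 (h₀ : ∀ d, {i | e₀ i = d}.Finite) (h₁ : ∀ d, {i | e₁ i = d}.Finite)
    (h₂ : ∀ d, {i | e₂ i = d}.Finite) (h₃ : ∀ d, {i | e₃ i = d}.Finite) (h₄ : ∀ d, {i | e₄ i = d}.Finite) :
    sigmaSeries (Sum.elim (fun i => -dm2 i) (Sum.elim K (Sum.elim (fun i => ds * K₁ i)
        (Sum.elim (fun i => K₁s i * d) (fun i => ds * K₂ i * d)))))
        (Sum.elim e₀ (Sum.elim e₁ (Sum.elim e₂ (Sum.elim e₃ e₄))))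
      = selfEnergy121 (sigmaSeries dm2 e₀) (sigmaSeries K e₁) (sigmaSeries K₁ e₂) (sigmaSeries K₁s e₃)
          (sigmaSeries K₂ e₄) (C d) (C ds) := by
  rw [sigmaSeries_sum5 _ _ _ _ _ e₀ e₁ e₂ e₃ e₄ h₀ h₁ h₂ h₃ h₄, sigmaSeries_neg h₀, sigmaSeries_const_mul h₂,
    sigmaSeries_mul_const h₃, sigmaSeries_const_mul_const h₄, selfEnergy121]

variable (C0 : R)

/-- **(1.21) WITH ITS PRINTED LETTERS, exactly in `R[[σ]]`**: the chain series `G` of the five-kind family satisfies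
`G = C₀ + G·(−δm² + Σ^ε + ∂^{ε*}Σ^ε_1 + Σ^{ε*}_1∂^ε + ∂^{ε*}Σ^ε_2∂^ε)·C₀` — r15's `Eq121 G (C C₀) (selfEnergy121 …)` — every letter a
formal power series in the couplings (`∂^ε, ∂^{ε*}, C₀` constants). PROVED. [cite: Balaban1983Higgs3, (1.21) p.416] -/
theorem eq121_selfEnergy121
    (n₀ : ∀ i, e₀ i ≠ 0) (n₁ : ∀ i, e₁ i ≠ 0) (n₂ : ∀ i, e₂ i ≠ 0) (n₃ : ∀ i, e₃ i ≠ 0) (n₄ : ∀ i, e₄ i ≠ 0)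
    (h₀ : ∀ d, {i | e₀ i = d}.Finite) (h₁ : ∀ d, {i | e₁ i = d}.Finite)
    (h₂ : ∀ d, {i | e₂ i = d}.Finite) (h₃ : ∀ d, {i | e₃ i = d}.Finite) (h₄ : ∀ d, {i | e₄ i = d}.Finite) :
    Eq121
      (greenSeries C0 (Sum.elim (fun i => -dm2 i) (Sum.elim K (Sum.elim (fun i => ds * K₁ i)
        (Sum.elim (fun i => K₁s i * d) (fun i => ds * K₂ i * d)))))
        (Sum.elim e₀ (Sum.elim e₁ (Sum.elim e₂ (Sum.elim e₃ e₄)))))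
      (C C0)
      (selfEnergy121 (sigmaSeries dm2 e₀) (sigmaSeries K e₁) (sigmaSeries K₁ e₂) (sigmaSeries K₁s e₃)
        (sigmaSeries K₂ e₄) (C d) (C ds)) := by
  rw [← sigmaSeries_selfEnergy121 e₀ e₁ e₂ e₃ e₄ dm2 K K₁ K₁s K₂ d ds h₀ h₁ h₂ h₃ h₄]
  exact eq121_greenSeries
    (sum_elim_ne_zero n₀ (sum_elim_ne_zero n₁ (sum_elim_ne_zero n₂ (sum_elim_ne_zero n₃ n₄))))
    (finite_fiber_sum_elim h₀ (finite_fiber_sum_elim h₁ (finite_fiber_sum_elim h₂ (finite_fiber_sum_elim h₃ h₄))))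

/-- **(1.21) LITERALLY, with its letters**: `G = Σ'_{n} C₀[(−δm² + Σ^ε + ∂^{ε*}Σ^ε_1 + Σ^{ε*}_1∂^ε + ∂^{ε*}Σ^ε_2∂^ε)C₀]ⁿ` in `R[[σ]]`
(product topology on coefficients, any Hausdorff topology on `R`). PROVED. [cite: Balaban1983Higgs3, (1.21) p.416] -/
theorem greenSeries_eq_tsum_selfEnergy121 [TopologicalSpace R] [T2Space R]
    (n₀ : ∀ i, e₀ i ≠ 0) (n₁ : ∀ i, e₁ i ≠ 0) (n₂ : ∀ i, e₂ i ≠ 0) (n₃ : ∀ i, e₃ i ≠ 0) (n₄ : ∀ i, e₄ i ≠ 0)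
    (h₀ : ∀ d, {i | e₀ i = d}.Finite) (h₁ : ∀ d, {i | e₁ i = d}.Finite)
    (h₂ : ∀ d, {i | e₂ i = d}.Finite) (h₃ : ∀ d, {i | e₃ i = d}.Finite) (h₄ : ∀ d, {i | e₄ i = d}.Finite) :
    open MvPowerSeries.WithPiTopology in
    greenSeries C0 (Sum.elim (fun i => -dm2 i) (Sum.elim K (Sum.elim (fun i => ds * K₁ i)
        (Sum.elim (fun i => K₁s i * d) (fun i => ds * K₂ i * d)))))
        (Sum.elim e₀ (Sum.elim e₁ (Sum.elim e₂ (Sum.elim e₃ e₄))))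
      = ∑' n, dysonTerm (C C0) (selfEnergy121 (sigmaSeries dm2 e₀) (sigmaSeries K e₁) (sigmaSeries K₁ e₂)
          (sigmaSeries K₁s e₃) (sigmaSeries K₂ e₄) (C d) (C ds)) n := by
  rw [← sigmaSeries_selfEnergy121 e₀ e₁ e₂ e₃ e₄ dm2 K K₁ K₁s K₂ d ds h₀ h₁ h₂ h₃ h₄]
  exact greenSeries_eq_tsum_dysonTerm
    (sum_elim_ne_zero n₀ (sum_elim_ne_zero n₁ (sum_elim_ne_zero n₂ (sum_elim_ne_zero n₃ n₄))))
    (finite_fiber_sum_elim h₀ (finite_fiber_sum_elim h₁ (finite_fiber_sum_elim h₂ (finite_fiber_sum_elim h₃ h₄))))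

/-- uniqueness with the letters: any `G` satisfying (1.21) in its resummed form with `X = selfEnergy121 …` is the chain series of
the five-kind family. PROVED. [cite: Balaban1983Higgs3, (1.21) p.416] -/
theorem eq_greenSeries_of_eq121_selfEnergy121
    (n₀ : ∀ i, e₀ i ≠ 0) (n₁ : ∀ i, e₁ i ≠ 0) (n₂ : ∀ i, e₂ i ≠ 0) (n₃ : ∀ i, e₃ i ≠ 0) (n₄ : ∀ i, e₄ i ≠ 0)
    (h₀ : ∀ d, {i | e₀ i = d}.Finite) (h₁ : ∀ d, {i | e₁ i = d}.Finite)
    (h₂ : ∀ d, {i | e₂ i = d}.Finite) (h₃ : ∀ d, {i | e₃ i = d}.Finite) (h₄ : ∀ d, {i | e₄ i = d}.Finite)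
    {G : MvPowerSeries σ R}
    (hG : Eq121 G (C C0) (selfEnergy121 (sigmaSeries dm2 e₀) (sigmaSeries K e₁) (sigmaSeries K₁ e₂)
      (sigmaSeries K₁s e₃) (sigmaSeries K₂ e₄) (C d) (C ds))) :
    G = greenSeries C0 (Sum.elim (fun i => -dm2 i) (Sum.elim K (Sum.elim (fun i => ds * K₁ i)
        (Sum.elim (fun i => K₁s i * d) (fun i => ds * K₂ i * d)))))
        (Sum.elim e₀ (Sum.elim e₁ (Sum.elim e₂ (Sum.elim e₃ e₄)))) := by
  rw [← sigmaSeries_selfEnergy121 e₀ e₁ e₂ e₃ e₄ dm2 K K₁ K₁s K₂ d ds h₀ h₁ h₂ h₃ h₄] at hG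
  exact eq_greenSeries_of_eq121
    (sum_elim_ne_zero n₀ (sum_elim_ne_zero n₁ (sum_elim_ne_zero n₂ (sum_elim_ne_zero n₃ n₄))))
    (finite_fiber_sum_elim h₀ (finite_fiber_sum_elim h₁ (finite_fiber_sum_elim h₂ (finite_fiber_sum_elim h₃ h₄)))) hG

end Letters

/-! ## §3 The letter `−δm²` with (1.23): `δm² = Σ_{2≦α+2β≦4} e^αλ^β δm²_{(α,β)}` as a formal series -/

section MassCounterterm

/-- the order `e^αλ^β` as an exponent vector in the two coupling letters `σ = Fin 2` (`0 ↦ e`, `1 ↦ λ`).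
[cite: Balaban1983Higgs3, (1.23) p.417] -/
theorem order123_ne_zero (ab : ℕ × ℕ) (hab : ab ∈ idx123) :
    Finsupp.single (0 : Fin 2) ab.1 + Finsupp.single 1 ab.2 ≠ 0 := by
  intro h
  have h0 := DFunLike.congr_fun h 0
  have h1 := DFunLike.congr_fun h 1
  simp only [Finsupp.coe_add, Pi.add_apply, Finsupp.single_eq_same, Finsupp.coe_zero, Pi.zero_apply,
    Finsupp.single_eq_of_ne (show (1 : Fin 2) ≠ 0 by decide), Finsupp.single_eq_of_ne (show (0 : Fin 2) ≠ 1 by decide),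
    add_zero, zero_add] at h0 h1
  have := (Finset.mem_filter.mp hab).2
  omega

/-- **(1.21)'s `δm²` in the form (1.23)**: indexing the mass-counterterm insertions by r15's `idx123` (the orders `(α, β)` with
`2 ≦ α + 2β ≦ 4`) with kernels `δm²_{(α,β)} ∈ R` and orders `e^αλ^β`, their series is the POLYNOMIAL
`Σ_{(α,β) ∈ idx123} e^αλ^β·δm²_{(α,β)}` — the formal-series form of (1.23) *"δm² = Σ_{2≦α+2β≦4} e^αλ^β δm²_{(α,β)}"* (r15's numeric
`dm2Of123` evaluates it at numbers `e, λ`). PROVED. [cite: Balaban1983Higgs3, (1.23) p.417] -/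
theorem sigmaSeries_idx123 (dm2c : ℕ × ℕ → R) :
    sigmaSeries (ι := idx123) (fun ab => dm2c ab.1)
        (fun ab => Finsupp.single (0 : Fin 2) ab.1.1 + Finsupp.single 1 ab.1.2)
      = ∑ ab ∈ idx123.attach, monomial (Finsupp.single (0 : Fin 2) ab.1.1 + Finsupp.single 1 ab.1.2) (dm2c ab.1) := by
  rw [sigmaSeries_eq_sum_monomial]
  rfl

end MassCounterterm

/-! ## §4 Transport: any indexing of the connected two-point graphs in bijection with the chains of 1PI pieces -/

section Transport

variable {γ ι : Type*} (C0 : R) (amp : ι → R) (deg : ι → σ →₀ ℕ) (ampγ : γ → R) (degγ : γ → σ →₀ ℕ)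

/-- **TRANSPORT ALONG THE CHAIN DECOMPOSITION**: if the connected two-point graphs are indexed by any type `γ` with kernels
`ampγ` and orders `degγ`, and `e : γ ≃ List ι` is a bijection onto the chains of 1PI pieces carrying each graph's kernel to the
chain kernel `C₀K₁C₀⋯K_mC₀` and its order to the sum of the orders of the pieces (the bridge decomposition, supplied as data), then
the generating series `Σ_g e^{degγ g}·ampγ g` of the connected graphs IS the chain series `greenSeries C₀ amp deg`. PROVED.
[cite: Balaban1983Higgs3, (1.21) p.416] -/
theorem sigmaSeries_eq_greenSeries_of_equiv (e : γ ≃ List ι) (hamp : ∀ g, ampγ g = chainAmp C0 amp (e g))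
    (hdeg : ∀ g, degγ g = chainDeg deg (e g)) :
    sigmaSeries ampγ degγ = greenSeries C0 amp deg := by
  ext d
  show (∑ᶠ (g : γ) (_ : degγ g = d), ampγ g) = ∑ᶠ (l : List ι) (_ : chainDeg deg l = d), chainAmp C0 amp l
  simp_rw [hamp, hdeg]
  exact finsum_comp_equiv e (f := fun l => ∑ᶠ (_ : chainDeg deg l = d), chainAmp C0 amp l)

/-- Hence (1.21) for the connected-graph series under such a bijection: `Eq121 (Σ_g e^{deg g}·amp g) (C C₀) X` exactly in
`R[[σ]]`. PROVED. [cite: Balaban1983Higgs3, (1.21) p.416] -/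
theorem eq121_sigmaSeries_of_equiv (e : γ ≃ List ι) (hamp : ∀ g, ampγ g = chainAmp C0 amp (e g))
    (hdeg : ∀ g, degγ g = chainDeg deg (e g)) (hne : ∀ i, deg i ≠ 0) (hfin : ∀ d, {i | deg i = d}.Finite) :
    Eq121 (sigmaSeries ampγ degγ) (C C0) (sigmaSeries amp deg) := by
  rw [sigmaSeries_eq_greenSeries_of_equiv C0 amp deg ampγ degγ e hamp hdeg]
  exact eq121_greenSeries hne hfin

/-- … and the printed series: `Σ_g e^{deg g}·amp g = Σ'_{n} C₀[XC₀]ⁿ` in `R[[σ]]`. PROVED. [cite: Balaban1983Higgs3, (1.21) p.416] -/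
theorem sigmaSeries_eq_tsum_dysonTerm_of_equiv [TopologicalSpace R] [T2Space R] (e : γ ≃ List ι)
    (hamp : ∀ g, ampγ g = chainAmp C0 amp (e g)) (hdeg : ∀ g, degγ g = chainDeg deg (e g))
    (hne : ∀ i, deg i ≠ 0) (hfin : ∀ d, {i | deg i = d}.Finite) :
    open MvPowerSeries.WithPiTopology in
    sigmaSeries ampγ degγ = ∑' n, dysonTerm (C C0) (sigmaSeries amp deg) n := by
  rw [sigmaSeries_eq_greenSeries_of_equiv C0 amp deg ampγ degγ e hamp hdeg]
  exact greenSeries_eq_tsum_dysonTerm hne hfin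

end Transport

end Literature.MathematicalPhysics.QuantumFieldTheory.Balaban1983to89.B3Eq121OnePIChainsLetters
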